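import Summits.QuantumFields.BalabanUV.T4Continuum.Support.NE9LevelCountsRecord
import Literature.Probability.LatticeModels.PolymerGasGeometric

/-!
# NE9LevelCountsAnimal — the (1.27) field `sumY` of the species LEVEL COUNTS ([II] p. 8: *"The sum is bounded by
# exp(8·12³exp(−½(κ₁−1))) ≦ e"*) KERNEL on the cell's torus model as a RELATIVE lattice-animal sum, with an explicit
# threshold (κ₁ ≥ 25 for anchors of ≤ 9⁴ cubes — the SINGLE-CUBE reading of □̃⁴; print's □̃⁴ is the 10-block, see BOX
# CONVENTION below, v1.0.1), by the component coding over the tree's polymer-gas combinatorics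
# (`Literature.Probability.LatticeModels.PolymerGasGeometric`) on `TreeLengthTorus`; then the owner's `LevelCountsG` on the
# carriers of record with THREE of its five fields kernel (sequel of «LC-REC», `NE9LevelCountsRecord` p215967) — cell
# `pub-balaban`, T4-DAG §2 node U3 / §6 NE9; rung (B)+1 on a FIXED finite T⁴; NE9 formalisation swarm, unit
# `b2b-balaban-t4-ne9-formalise-leaf-01` gen 7, own-initiative lineage item «LC-127», journal CLAIM l.11702; nothing of any
# import is modified.  v1.0.1 (gen 27) = DOCFIX-LOW asked by the row owner t4-ne9-p1 gen 36 (journal l.20591, located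
# self-correction O-ne9p1g36-1): docstrings only, every declaration byte-identical to v1 (p216359)

HONEST FRAMING (T4-DAG PAGE 1).  Rung (B)+1 = existence and uniqueness of the ε → 0 limit of gauge-invariant observables on a
FIXED finite torus T⁴ — NOT infinite volume, NOT a mass gap, NOT the Clay problem.  NE9 (`T4OutputRate.NE9` ∧ `FadingMemory`) is
a cell NEW ESTIMATE, NOT PRINTED and NOT discharged here («NE9 ⇐ the named binders»); spine 0/9; 0/18 skeleton leaves
instantiated on Bałaban's objects (O-NE9-1).  HONEST DEPENDENCY (cell line, verbatim): continuum YM on T⁴ ⇐ BetaPertH ∧ nine spine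
estimates (0/9 proved); BetaPertH ⇐ (D1) ∧ (D4) ∧ CAP+tail; G-an2-4 gates asym, D1 and NE2/3/4.  `FlowStep.BetaPertH`, (B), (B^μ)
do not occur.  [II] = [Balaban1988RG2Cluster] (CMP **116**) is quoted for TYPES only (ABSOLUTE RULE: nothing printed in the
audited series is asserted); (1.27) is printed with the numeral quoted in `NE9Lemma1Counting.LevelCounts`.

WHERE THIS SITS.  The owner's level-count structure `LevelCountsG P κ κ₁ O1 c_Q gain ℓ` (`NE9Lemma1Gain`) has five fields; «LC-REC»
(p215967) made (1.26) `sumX` and (1.28) `count0` kernel on the carriers of record.  The (1.27) field reads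
`sumY : ∀ k y, ∀ □₀ ∈ S0 k y, Σ_{Y₀ ∈ SY k y □₀} exp(−½(κ₁−1)·vol k y □₀ Y₀) ≤ e`, with `vol = M⁻⁴|Y₀ ∖ □̃⁴|` and Y₀ ranging
over the connected domains containing the anchor □̃⁴ ([II] (1.27) p. 8).  This is a RELATIVE lattice-animal sum: only the cubes
added to the anchor are paid for, and its bound is `exp(#anchor·(Δ+1)·2λ)` at activity `λ = e^{−½(κ₁−1)}` with
`(Δ+1)²λ ≤ ½` — the standard component coding: `Y₀ ↦ Y₀ ∖ □̃⁴`, whose connected components all TOUCH the anchor, then the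
sub-families of the connected sets touching the anchor, `Π (1 + λ^{#C}) ≤ exp Σ λ^{#C}`, and the tree's
`sum_kpWeight_le_of_touches` (Friedli–Velenik (5.27) through `sum_pow_card_le_of_connected`).  THIS FILE:
* §1 GENERIC (cells `V`, symmetric adjacency `R` with neighbour lists of size ≤ Δ): **`rcomponents_touch_of_connected`**
  (if `Y` is `R`-connected and `A ⊆ Y` then every component of `Y ∖ A` touches `A`), `pairwiseDisjoint_rcomponents`,
  `card_eq_sum_card_rcomponents`, `pow_card_eq_prod_rcomponents`, `rcomponents_injective`,
  **`sum_pow_card_le_exp_of_touch`** (`Σ_{B ∈ 𝓑} λ^{#B} ≤ exp(#A·(Δ+1)·2λ)` when every component of every `B ∈ 𝓑` touches `A`),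
  **`sum_exp_card_sdiff_le_exp`** (`Σ_{Y ∈ 𝒴} exp(−a·#(Y ∖ A)) ≤ exp(#A·(Δ+1)·2e^{−a})` for `R`-connected `Y ⊇ A`);
* §2 ON THE TORUS `(ℤ/N)^d` (`V := TPt d N`, `R := TAdj`, `nbr := tnbr`, `Δ := 2d` — `TreeLengthTorus.tdegreeLE`): **`sumY_torus`**,
  the «≤ e» corner **`sumY_torus_le_exp_one`**, and the d = 4 numerals **`smallness_four_of_le`**: for `a ≥ 12` (i.e. κ₁ ≥ 25 at
  `a = ½(κ₁−1)`) and anchors of `≤ 6561 = 9⁴` cubes both smallness conditions hold (`81·e^{−a} ≤ ½`, `6561·9·2·e^{−a} ≤ 1`,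
  from `e¹² > 118 098`);
* §3 ON THE CARRIERS OF RECORD in the owner's field shape: **`sumY_of_record`** — if the domains `P.SY k y □₀` read INJECTIVELY
  as torus-face-connected families of scale-`k` cubes containing a displayed anchor `Anc k y □₀` of ≤ 6561 cubes (*"Y₀ ⊃ □̃⁴"*)
  and `P.vol k y □₀ Y₀` is the number of added cubes, then the (1.27) field holds for `κ₁ ≥ 25`; and
  **`levelCountsG_of_record₃`** = «LC-REC»'s `levelCountsG_of_record` with `sumY` ALSO kernel: three fields kernel (`sumX` at
  κ ≥ 144 with O1 := m·(2²⁰+1), `count0` and `sumY` at κ₁ ≥ 69), `cover` and the □′-count `countQ` displayed.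
BOX CONVENTION (v1.0.1 DOCFIX-LOW; located self-correction O-ne9p1g36-1 of the row owner, `NE9SpeciesFrameConvention` p233138).
The numerals `6561 = 9⁴` (anchor □̃⁴ of side `1 + 2·4` cubes) in `smallness_four_of_le`, `sumY_of_record` and
`levelCountsG_of_record₃` are the SINGLE-CUBE reading of print's «□» (□ = ONE cube of π_k, □̃ⁿ = the centred ball of
`(2n+1)⁴` cubes).  Print's «□» is the 2ᵈ-BLOCK: [I] = [Balaban1987RG1] p. 270 *"We construct a cover of the space T by
cubes □, which are unions of 2ᵈ neighbouring cubes from π_k"*, and `X̃ⁿ` adds `n` layers of cubes ([I] p. 262 *"X̃⁻² is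
obtained from X by taking away two layers of cubes"*), so print's □̃⁴ is the 10-BLOCK of `10⁴` cubes (□̃² = 6⁴, □₀ = □̃⁵ = 12⁴;
[II] p. 8 *"(6L)⁴"*, *"8·12³"*) and `#□̃⁴ ≤ 6561` FAILS for it.  Every theorem below is TRUE AS STATED (it is about the
anchors it names); the kernel is unchanged; the letter for print's frame — indeed for ANY anchor of `≤ 10¹²` cubes at
κ₁ ≥ 69, the END's letter — is the owner's `NE9SpeciesFrameConvention.smallness_four_of_card_le` ∕ `sumY_conv` (p233138),
which applies THIS file's generic corner `sumY_torus_le_exp_one` BY NAME at `printConvention`.  Nothing here is re-derived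
for the 10-block: at `a ≥ 12` the second smallness condition `10⁴·9·2·e^{−a} ≤ 1` is false (`e¹² < 180 000`); it holds from
`a ≥ 13` (κ₁ ≥ 27), a corner nobody consumes (the END reads κ₁ ≥ 69).
DISGUISE TEST: lattice combinatorics composed BY NAME with the tree's polymer-gas tools; the readings of a species frame on
Bałaban's (1.33) objects (anchors □̃⁴, domains Y₀, boxes □₀, fibres) are O-NE9-1; no activity, no history — not NE9, not NE5.

References (TYPES only): T. Bałaban, *Renormalization group approach to lattice gauge field theories. II. Cluster expansions*,
Commun. Math. Phys. **116** (1988) 1–22 [Balaban1988RG2Cluster], (1.27) p. 8; T. Bałaban, *Renormalization group approach to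
lattice gauge field theories. I*, Commun. Math. Phys. **109** (1987) 249–301 [Balaban1987RG1], p. 262 and p. 270 (the cover by
2ᵈ-blocks and the layers `X̃ⁿ` — the BOX CONVENTION gloss of v1.0.1, TYPES only); S. Friedli, Y. Velenik, *Statistical Mechanics of
Lattice Systems*, CUP (2017), (5.27) and §5.7.1 [FriedliVelenik2017] (the animal count, via the tree's `PolymerGasGeometric`).
Summits-side NEW work (LEAN PLACEMENT RULE); imports «LC-REC» `NE9LevelCountsRecord` (p215967) and the tree's
`Literature.Probability.LatticeModels.PolymerGasGeometric` ONLY; modifies nothing; 0 `def`, 0 `def … : Prop`, 0 sorry.  Value =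
bookkeeping: the third of the five displayed counting fields of every species END made kernel on the carriers of record with a
certified threshold, NOT summit progress.
-/

noncomputable section

open scoped BigOperators

namespace Summit.QuantumFields.BalabanUV.T4Continuum.NE9LevelCountsAnimal

open Literature.Probability.LatticeModels
open Literature.MathematicalPhysics.QuantumFieldTheory.Balaban1983to89
open Literature.MathematicalPhysics.QuantumFieldTheory.Balaban1983to89.T4OutputRate (Carriers)
open Literature.MathematicalPhysics.QuantumFieldTheory.Balaban1983to89.TreeLengthTorus
  (TPt TAdj TFaceConnected TDom tnbr mem_tnbr isRConnected_of_tFaceConnected)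
open Summit.QuantumFields.BalabanUV.T4Continuum.B13Carriers (TwoRuns)
open Summit.QuantumFields.BalabanUV.T4Continuum.B13DomainGeometryTR
open Summit.QuantumFields.BalabanUV.T4Continuum.NE9Lemma1Counting
open Summit.QuantumFields.BalabanUV.T4Continuum.NE9Lemma1Gain
open Summit.QuantumFields.BalabanUV.T4Continuum.NE9LevelCountsRecord

/-! ## §1 Generic: the relative animal sum by the component coding -/

section Generic

variable {V : Type*} [DecidableEq V] {R : V → V → Prop}

/-- **Every component of `Y ∖ A` touches `A`** when `Y` is `R`-connected (`R` symmetric) and `A ⊆ Y`: follow a chain inside `Y`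
from a cell of the component to a cell of `A`; its first step leaving the component lands in `A` (a step landing in `Y ∖ A` would
stay in the component). [folklore] -/
theorem rcomponents_touch_of_connected (hR : ∀ x y, R x y → R y x) {Y A : Finset V} (hY : IsRConnected R Y)
    (hA : A ⊆ Y) (hAne : A.Nonempty) {C : Finset V} (hC : C ∈ rcomponents R (Y \ A)) : Touches R A C := by
  obtain ⟨p, hp, rfl⟩ := mem_rcomponents_iff.1 hC
  obtain ⟨a, ha⟩ := hAne
  have hpY : p ∈ Y := (Finset.mem_sdiff.1 hp).1
  have hchain := hY.2 p hpY a (hA ha)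
  have haC : a ∉ rcomponent R (Y \ A) p := fun h =>
    (Finset.mem_sdiff.1 (rcomponent_subset _ _ h)).2 ha
  -- first exit of the chain from the component (pure logic, by induction on the chain)
  have key : ∀ w, Relation.ReflTransGen (fun x y => R x y ∧ x ∈ Y ∧ y ∈ Y) p w → w ∉ rcomponent R (Y \ A) p →
      ∃ x y, (R x y ∧ x ∈ Y ∧ y ∈ Y) ∧ x ∈ rcomponent R (Y \ A) p ∧ y ∉ rcomponent R (Y \ A) p := by
    intro w h
    induction h with
    | refl => exact fun hn => absurd (mem_rcomponent_self hp) hn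
    | @tail c e _ hce ih =>
      intro he
      by_cases hc : c ∈ rcomponent R (Y \ A) p
      · exact ⟨c, e, hce, hc, he⟩
      · exact ih hc
  obtain ⟨x, y, ⟨hxy, -, hyY⟩, hx, hy⟩ := key a hchain haC
  by_cases hyA : y ∈ A
  · exact ⟨y, hyA, x, hx, Or.inr (hR _ _ hxy)⟩
  · -- `y ∈ Y ∖ A` adjacent to the component: it belongs to it
    exfalso
    apply hy
    have hyB : y ∈ Y \ A := Finset.mem_sdiff.2 ⟨hyY, hyA⟩
    obtain ⟨hxB, hpx⟩ := mem_rcomponent.1 hx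
    exact mem_rcomponent.2 ⟨hyB, hpx.tail ⟨hxy, hxB, hyB⟩⟩

/-- Distinct components are disjoint (`R` symmetric). [folklore] -/
theorem pairwiseDisjoint_rcomponents (hR : ∀ x y, R x y → R y x) (Q : Finset V) :
    ((rcomponents R Q : Finset (Finset V)) : Set (Finset V)).PairwiseDisjoint id := by
  intro X hX X' hX' hne
  obtain ⟨p, -, rfl⟩ := mem_rcomponents_iff.1 (Finset.mem_coe.1 hX)
  obtain ⟨p', -, rfl⟩ := mem_rcomponents_iff.1 (Finset.mem_coe.1 hX')
  rw [Function.onFun, Finset.disjoint_left]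
  intro q hq hq'
  exact hne (eq_of_touches_rcomponent hR ⟨q, hq, q, hq', Or.inl rfl⟩)

/-- The cardinality of a finite cell set is the sum of the cardinalities of its components. [folklore] -/
theorem card_eq_sum_card_rcomponents (hR : ∀ x y, R x y → R y x) (Q : Finset V) :
    Q.card = ∑ C ∈ rcomponents R Q, C.card := by
  conv_lhs => rw [← biUnion_rcomponents (R := R) Q]
  rw [Finset.card_biUnion (pairwiseDisjoint_rcomponents hR Q)]
  rfl

/-- `λ^{#B} = Π_{C ∈ components B} λ^{#C}`. [folklore] -/
theorem pow_card_eq_prod_rcomponents (hR : ∀ x y, R x y → R y x) (lam : ℝ) (Q : Finset V) :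
    lam ^ Q.card = ∏ C ∈ rcomponents R Q, lam ^ C.card := by
  rw [card_eq_sum_card_rcomponents hR Q, Finset.prod_pow_eq_pow_sum]

omit [DecidableEq V] in
/-- A finite cell set is determined by its family of components. [folklore] -/
theorem rcomponents_injective [DecidableEq V] : Function.Injective (rcomponents R : Finset V → Finset (Finset V)) := by
  intro Q Q' h
  rw [← biUnion_rcomponents (R := R) Q, ← biUnion_rcomponents (R := R) Q', h]

variable {nbr : V → Finset V} {Δ : ℕ}

/-- **THE RELATIVE ANIMAL SUM** (generic).  `R` symmetric with neighbour lists of size ≤ Δ, `0 ≤ λ`, `(Δ+1)²λ ≤ ½`; `A` a finite set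
of cells; `𝓑` a finite family of finite cell sets EVERY COMPONENT OF EACH OF WHICH TOUCHES `A`.  Then
`Σ_{B ∈ 𝓑} λ^{#B} ≤ exp(#A·(Δ+1)·2λ)`: `B ↦ components B` is injective into the sub-families of the (finite) family `𝒯` of all
occurring components, `Σ_{𝒞 ⊆ 𝒯} Π_{C ∈ 𝒞} λ^{#C} = Π_{C ∈ 𝒯} (1 + λ^{#C}) ≤ exp(Σ_{C ∈ 𝒯} λ^{#C})`, and the members of `𝒯` are
connected and touch `A` (`sum_kpWeight_le_of_touches`). [cite: FriedliVelenik2017, (5.27) and Sect. 5.7.1] -/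
theorem sum_pow_card_le_exp_of_touch [DecidableRel R] (hR : ∀ x y, R x y → R y x) (hΔ : ∀ x, (nbr x).card ≤ Δ)
    (hnbr : ∀ x y, R x y → y ∈ nbr x) {lam : ℝ} (hlam : 0 ≤ lam) (hsmall : ((Δ : ℝ) + 1) ^ 2 * lam ≤ 1 / 2)
    (A : Finset V) (𝓑 : Finset (Finset V)) (h𝓑 : ∀ B ∈ 𝓑, ∀ C ∈ rcomponents R B, Touches R A C) :
    ∑ B ∈ 𝓑, lam ^ B.card ≤ Real.exp (A.card * ((Δ : ℝ) + 1) * (2 * lam)) := by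
  classical
  set 𝒯 : Finset (Finset V) := 𝓑.biUnion (rcomponents R) with h𝒯
  -- 1. components: λ^{#B} = Π over components, and B ↦ components B is injective into 𝒯.powerset
  have h1 : ∑ B ∈ 𝓑, lam ^ B.card = ∑ 𝒞 ∈ 𝓑.image (rcomponents R), ∏ C ∈ 𝒞, lam ^ C.card := by
    rw [Finset.sum_image fun B _ B' _ h => rcomponents_injective h]
    exact Finset.sum_congr rfl fun B _ => pow_card_eq_prod_rcomponents hR lam B
  have h2 : ∑ 𝒞 ∈ 𝓑.image (rcomponents R), ∏ C ∈ 𝒞, lam ^ C.card ≤ ∑ 𝒞 ∈ 𝒯.powerset, ∏ C ∈ 𝒞, lam ^ C.card := by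
    refine Finset.sum_le_sum_of_subset_of_nonneg ?_ fun 𝒞 _ _ => Finset.prod_nonneg fun C _ => pow_nonneg hlam _
    intro 𝒞 h𝒞
    obtain ⟨B, hB, rfl⟩ := Finset.mem_image.1 h𝒞
    exact Finset.mem_powerset.2 (Finset.subset_biUnion_of_mem (rcomponents R) hB)
  -- 2. the powerset sum is the product Π (1 + λ^{#C}) ≤ exp Σ λ^{#C}
  have h3 : ∑ 𝒞 ∈ 𝒯.powerset, ∏ C ∈ 𝒞, lam ^ C.card = ∏ C ∈ 𝒯, (1 + lam ^ C.card) :=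
    (Finset.prod_one_add 𝒯).symm
  have h4 : ∏ C ∈ 𝒯, (1 + lam ^ C.card) ≤ Real.exp (∑ C ∈ 𝒯, lam ^ C.card) := by
    rw [Real.exp_sum]
    exact Finset.prod_le_prod (fun C _ => by positivity) fun C _ => by
      have := Real.add_one_le_exp (lam ^ C.card); linarith
  -- 3. the members of 𝒯 are connected and touch A: the tree's touching-polymer bound
  have h5 : ∑ C ∈ 𝒯, lam ^ C.card ≤ A.card * ((Δ : ℝ) + 1) * (2 * lam) := by
    have hconn : ∀ C ∈ 𝒯, IsRConnected R C := by
      intro C hC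
      obtain ⟨B, -, hCB⟩ := Finset.mem_biUnion.1 hC
      obtain ⟨p, hp, rfl⟩ := mem_rcomponents_iff.1 hCB
      exact isRConnected_rcomponent hR hp
    have heq : ∑ C ∈ 𝒯, lam ^ C.card = ∑ C ∈ 𝒯, kpWeight R lam C :=
      Finset.sum_congr rfl fun C hC => by unfold kpWeight; rw [if_pos (hconn C hC)]
    rw [heq]
    refine sum_kpWeight_le_of_touches hR hΔ hnbr hlam hsmall A 𝒯 fun C hC => Or.inr ?_
    obtain ⟨B, hB, hCB⟩ := Finset.mem_biUnion.1 hC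
    exact h𝓑 B hB C hCB
  calc ∑ B ∈ 𝓑, lam ^ B.card = ∑ 𝒞 ∈ 𝓑.image (rcomponents R), ∏ C ∈ 𝒞, lam ^ C.card := h1
    _ ≤ ∑ 𝒞 ∈ 𝒯.powerset, ∏ C ∈ 𝒞, lam ^ C.card := h2
    _ = ∏ C ∈ 𝒯, (1 + lam ^ C.card) := h3
    _ ≤ Real.exp (∑ C ∈ 𝒯, lam ^ C.card) := h4
    _ ≤ Real.exp (A.card * ((Δ : ℝ) + 1) * (2 * lam)) := Real.exp_le_exp.2 h5

/-- **THE RELATIVE ANIMAL SUM OVER CONNECTED SUPERSETS OF AN ANCHOR**: for a nonempty finite anchor `A` and a finite family `𝒴` of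
`R`-connected sets containing `A`, `Σ_{Y ∈ 𝒴} exp(−a·#(Y ∖ A)) ≤ exp(#A·(Δ+1)·2e^{−a})` as soon as `(Δ+1)²e^{−a} ≤ ½`
(`Y ↦ Y ∖ A` is injective on supersets of `A`; `rcomponents_touch_of_connected`; `sum_pow_card_le_exp_of_touch` at `λ = e^{−a}`).
[cite: FriedliVelenik2017, (5.27) and Sect. 5.7.1] -/
theorem sum_exp_card_sdiff_le_exp [DecidableRel R] (hR : ∀ x y, R x y → R y x) (hΔ : ∀ x, (nbr x).card ≤ Δ)
    (hnbr : ∀ x y, R x y → y ∈ nbr x) {a : ℝ} (hsmall : ((Δ : ℝ) + 1) ^ 2 * Real.exp (-a) ≤ 1 / 2)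
    {A : Finset V} (hAne : A.Nonempty) (𝒴 : Finset (Finset V)) (h𝒴 : ∀ Y ∈ 𝒴, A ⊆ Y ∧ IsRConnected R Y) :
    ∑ Y ∈ 𝒴, Real.exp (-(a * ((Y \ A).card : ℝ))) ≤ Real.exp (A.card * ((Δ : ℝ) + 1) * (2 * Real.exp (-a))) := by
  classical
  have hinj : Set.InjOn (fun Y : Finset V => Y \ A) ↑𝒴 := by
    intro Y hY Y' hY' h
    have e1 : Y \ A ∪ A = Y := Finset.sdiff_union_of_subset (h𝒴 Y hY).1
    have e2 : Y' \ A ∪ A = Y' := Finset.sdiff_union_of_subset (h𝒴 Y' hY').1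
    rw [← e1, ← e2]
    exact congrArg (· ∪ A) h
  have hexp : ∀ Y ∈ 𝒴, Real.exp (-(a * ((Y \ A).card : ℝ))) = Real.exp (-a) ^ (Y \ A).card := by
    intro Y _
    rw [← Real.exp_nat_mul]; ring_nf
  rw [Finset.sum_congr rfl hexp, ← Finset.sum_image (f := fun B : Finset V => Real.exp (-a) ^ B.card) hinj]
  refine sum_pow_card_le_exp_of_touch hR hΔ hnbr (Real.exp_pos _).le hsmall A _ fun B hB C hC => ?_
  obtain ⟨Y, hY, rfl⟩ := Finset.mem_image.1 hB
  exact rcomponents_touch_of_connected hR (h𝒴 Y hY).2 (h𝒴 Y hY).1 hAne hC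

end Generic

/-! ## §2 On the torus `(ℤ/N)^d`: cubes `TPt d N`, wall adjacency `TAdj`, degree `2d` -/

section Torus

variable {d N : ℕ} [NeZero N]

/-- **THE (1.27)-TYPE SUM ON THE TORUS MODEL**: for a nonempty anchor `A` of cubes of `(ℤ/N)^d` and a finite family `𝒴` of
nonempty torus-face-connected families of cubes containing `A`, at any rate `a` with `(2d+1)²·e^{−a} ≤ ½`:
`Σ_{Y ∈ 𝒴} exp(−a·#(Y ∖ A)) ≤ exp(#A·(2d+1)·2e^{−a})` (§1 at `R := TAdj`, `nbr := tnbr`, `Δ := 2d` — `TreeLengthTorus.tdegreeLE`).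
[cite: Balaban1988RG2Cluster, (1.27) p.8] -/
theorem sumY_torus {a : ℝ} (hsmall : ((2 * d : ℕ) + 1 : ℝ) ^ 2 * Real.exp (-a) ≤ 1 / 2) {A : Finset (TPt d N)}
    (hAne : A.Nonempty) (𝒴 : Finset (Finset (TPt d N)))
    (h𝒴 : ∀ Y ∈ 𝒴, A ⊆ Y ∧ Y.Nonempty ∧ TFaceConnected Y) :
    ∑ Y ∈ 𝒴, Real.exp (-(a * ((Y \ A).card : ℝ))) ≤
      Real.exp (A.card * (((2 * d : ℕ) : ℝ) + 1) * (2 * Real.exp (-a))) := by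
  classical
  have hΔ : ∀ x : TPt d N, (tnbr x).card ≤ 2 * d := fun x => TreeLengthTorus.tdegreeLE d N x
  exact sum_exp_card_sdiff_le_exp (R := TAdj) (nbr := tnbr) (fun _ _ h => h.symm) hΔ (fun _ _ h => mem_tnbr.2 h)
    (by exact_mod_cast hsmall) hAne 𝒴 fun Y hY => ⟨(h𝒴 Y hY).1, isRConnected_of_tFaceConnected (h𝒴 Y hY).2.1 (h𝒴 Y hY).2.2⟩

/-- **THE «≤ e» CORNER**: if moreover `#A·(2d+1)·2e^{−a} ≤ 1`, the sum is `≤ e` — the printed shape of (1.27).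
[cite: Balaban1988RG2Cluster, (1.27) p.8] -/
theorem sumY_torus_le_exp_one {a : ℝ} (hsmall : ((2 * d : ℕ) + 1 : ℝ) ^ 2 * Real.exp (-a) ≤ 1 / 2)
    {A : Finset (TPt d N)} (hAne : A.Nonempty) (hA : (A.card : ℝ) * (((2 * d : ℕ) : ℝ) + 1) * (2 * Real.exp (-a)) ≤ 1)
    (𝒴 : Finset (Finset (TPt d N))) (h𝒴 : ∀ Y ∈ 𝒴, A ⊆ Y ∧ Y.Nonempty ∧ TFaceConnected Y) :
    ∑ Y ∈ 𝒴, Real.exp (-(a * ((Y \ A).card : ℝ))) ≤ Real.exp 1 :=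
  (sumY_torus hsmall hAne 𝒴 h𝒴).trans (Real.exp_le_exp.2 hA)

/-- **NUMERALS, d = 4**: for `a ≥ 12` and an anchor of at most `6561 = 9⁴` cubes (SINGLE-CUBE reading: □̃⁴ has side `(1 + 2·4)`
cubes when □ is ONE cube of π_k; print's □ is the 2⁴-block and print's □̃⁴ the 10-block of `10⁴` cubes — O-ne9p1g36-1, see the
header's BOX CONVENTION; that letter is `NE9SpeciesFrameConvention.smallness_four_of_card_le`, `a ≥ 34`, anchors `≤ 10¹²`), both
smallness conditions hold: `(2·4+1)²·e^{−a} ≤ ½` and `#A·(2·4+1)·2·e^{−a} ≤ 1` (`e¹² > 118 098 = 2·9·6561`, from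
`e > 2.7182818283`).  At `a = ½(κ₁−1)` this is **κ₁ ≥ 25**. [folklore] -/
theorem smallness_four_of_le {a : ℝ} (ha : 12 ≤ a) {nA : ℝ} (hnA : nA ≤ 6561) :
    ((2 * 4 : ℕ) + 1 : ℝ) ^ 2 * Real.exp (-a) ≤ 1 / 2 ∧ nA * (((2 * 4 : ℕ) : ℝ) + 1) * (2 * Real.exp (-a)) ≤ 1 := by
  have he : (118098 : ℝ) < Real.exp 12 := by
    have h1 := Real.exp_one_gt_d9
    have h2 : Real.exp 12 = Real.exp 1 ^ 12 := by rw [← Real.exp_nat_mul]; norm_num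
    rw [h2]
    have h3 : (2.7182818283 : ℝ) ^ 12 ≤ Real.exp 1 ^ 12 := by
      exact pow_le_pow_left₀ (by norm_num) h1.le 12
    have h4 : (118098 : ℝ) < (2.7182818283 : ℝ) ^ 12 := by norm_num
    linarith
  have hexp : Real.exp (-a) ≤ Real.exp (-12) := Real.exp_le_exp.2 (by linarith)
  have h12 : Real.exp (-12) * Real.exp 12 = 1 := by rw [← Real.exp_add]; norm_num
  have hpos : 0 < Real.exp 12 := Real.exp_pos 12
  have hinv : Real.exp (-12) ≤ 1 / 118098 := by
    rw [le_div_iff₀ (by norm_num : (0:ℝ) < 118098)]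
    nlinarith
  have hea : 0 ≤ Real.exp (-a) := (Real.exp_pos _).le
  constructor
  · push_cast
    nlinarith
  · push_cast
    nlinarith

end Torus

/-! ## §3 On the carriers of record, in the owner's field shape -/

section Record

variable {G : Type} [GaugeGroup G] (R : TwoRuns G)
variable {C : Carriers} {Bg ι α β γ : Type}

/-- **THE (1.27) FIELD `sumY` OF THE LEVEL COUNTS ON THE CARRIERS OF RECORD.**  For a piece frame `P` whose connected domains
`P.SY k y □₀` read INJECTIVELY (`dom`) as nonempty torus-face-connected families of cubes of the scale-`k` torus
`(ℤ/(cubesPerDir k))⁴` of the record containing a nonempty displayed anchor `Anc k y □₀` of at most `6561 = 9⁴` cubes (O1-side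
identification: *"Y₀ ⊃ □̃⁴, Y₀ connected"*; `6561` is the SINGLE-CUBE reading of □̃⁴ — print's □̃⁴ is the 10-block, O-ne9p1g36-1,
served by `NE9SpeciesFrameConvention.sumY_conv`), and whose volume field counts the added cubes, `P.vol k y □₀ Y₀ = #(dom Y₀ ∖ Anc)`
(*"M⁻⁴|Y₀∖□̃⁴|"*), the (1.27) field holds for `κ₁ ≥ 25`: `Σ_{Y₀ ∈ P.SY k y □₀} exp(−½(κ₁−1)·vol) ≤ e` (§2 at d = 4).
[cite: Balaban1988RG2Cluster, (1.27) p.8] -/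
theorem sumY_of_record (P : PieceData C Bg ι α β γ)
    (Anc : (k : ℕ) → ι → α → Finset (TPt 4 (R.cubesPerDir k)))
    (dom : (k : ℕ) → ι → α → β → Finset (TPt 4 (R.cubesPerDir k)))
    (hinj : ∀ (k : ℕ) (y : ι) (a : α), Set.InjOn (dom k y a) ↑(P.SY k y a))
    (hdom : ∀ (k : ℕ) (y : ι) (a : α), ∀ b ∈ P.SY k y a,
      Anc k y a ⊆ dom k y a b ∧ (dom k y a b).Nonempty ∧ TFaceConnected (dom k y a b))
    (hAnc : ∀ (k : ℕ) (y : ι) (a : α), (Anc k y a).Nonempty ∧ (Anc k y a).card ≤ 6561)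
    (hvol : ∀ (k : ℕ) (y : ι) (a : α), ∀ b ∈ P.SY k y a, P.vol k y a b = ((dom k y a b \ Anc k y a).card : ℝ))
    {κ₁ : ℝ} (hκ₁ : 25 ≤ κ₁) (k : ℕ) (y : ι) (a : α) :
    ∑ b ∈ P.SY k y a, Real.exp (-(1 / 2) * (κ₁ - 1) * P.vol k y a b) ≤ Real.exp 1 := by
  classical
  have hs := smallness_four_of_le (a := (1 / 2) * (κ₁ - 1)) (by linarith) (nA := ((Anc k y a).card : ℝ))
    (by exact_mod_cast (hAnc k y a).2)
  have heq : ∑ b ∈ P.SY k y a, Real.exp (-(1 / 2) * (κ₁ - 1) * P.vol k y a b) =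
      ∑ Y ∈ (P.SY k y a).image (dom k y a), Real.exp (-((1 / 2) * (κ₁ - 1) * ((Y \ Anc k y a).card : ℝ))) := by
    rw [Finset.sum_image (hinj k y a)]
    refine Finset.sum_congr rfl fun b hb => ?_
    rw [hvol k y a b hb]; ring_nf
  rw [heq]
  refine sumY_torus_le_exp_one (d := 4) hs.1 (hAnc k y a).1 hs.2 _ fun Y hY => ?_
  obtain ⟨b, hb, rfl⟩ := Finset.mem_image.1 hY
  exact hdom k y a b hb

/-- **THE SPECIES LEVEL COUNTS ON THE CARRIERS OF RECORD, THREE FIELDS KERNEL** — «LC-REC»'s `levelCountsG_of_record`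
(`sumX` at κ ≥ 144 with O1 := m·(2²⁰+1), `count0` at κ₁ ≥ 69) with the (1.27) field `sumY` ALSO produced (`sumY_of_record`,
κ₁ ≥ 25 ≤ 69); displayed: the readings (LC-REC's `rd`/`cube`/`Yout` + this file's `Anc`/`dom`), the □′-cover `hcover` and the
□′-count `hcountQ` only.  (Anchor letter `≤ 6561` = the SINGLE-CUBE reading of □̃⁴, O-ne9p1g36-1; at print's box convention the
five fields are `NE9SpeciesFrameConvention.levelCountsG_conv`.) [cite: Balaban1988RG2Cluster, (1.26)-(1.28) p.8, (2.30) p.18] -/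
theorem levelCountsG_of_record₃ (P : PieceData C Bg ι α β γ) {κ κ₁ cQ : ℝ} {gain ℓ : ℕ → ℕ → ℝ}
    -- LC-REC's readings: (1.26) and (1.28) sides
    (rd : C.Dom → R.carriers.Dom) (hd : ∀ x, C.d x = R.carriers.d (rd x)) {m : ℕ}
    (hm : ∀ (k : ℕ) (y : ι) (a : α) (j : ℕ) (q : γ) (Y : R.carriers.Dom),
      ((((P.SX k y a j q).filter fun x => rd x = Y).card : ℕ) : ℝ) ≤ m)
    (cube : ℕ → ι → α → ℕ → γ → SCube R)
    (hSX : ∀ (k : ℕ) (y : ι) (a : α) (j : ℕ) (q : γ), ∀ x ∈ P.SX k y a j q,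
      rd x ∈ R.domAt j ∧ cube k y a j q ∈ footprint (rd x))
    (hκ : 144 ≤ κ)
    (Yout : ℕ → ι → R.carriers.Dom)
    (hS0 : ∀ (k : ℕ) (y : ι), (P.S0 k y).card ≤ (footprint (Yout k y)).card)
    (hdY : ∀ (k : ℕ) (y : ι), 1 + R.carriers.d (Yout k y) ≤ P.dY k y) (hκ₁ : 69 ≤ κ₁)
    -- this file's readings: (1.27) side
    (Anc : (k : ℕ) → ι → α → Finset (TPt 4 (R.cubesPerDir k)))
    (dom : (k : ℕ) → ι → α → β → Finset (TPt 4 (R.cubesPerDir k)))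
    (hinj : ∀ (k : ℕ) (y : ι) (a : α), Set.InjOn (dom k y a) ↑(P.SY k y a))
    (hdom : ∀ (k : ℕ) (y : ι) (a : α), ∀ b ∈ P.SY k y a,
      Anc k y a ⊆ dom k y a b ∧ (dom k y a b).Nonempty ∧ TFaceConnected (dom k y a b))
    (hAnc : ∀ (k : ℕ) (y : ι) (a : α), (Anc k y a).Nonempty ∧ (Anc k y a).card ≤ 6561)
    (hvol : ∀ (k : ℕ) (y : ι) (a : α), ∀ b ∈ P.SY k y a, P.vol k y a b = ((dom k y a b \ Anc k y a).card : ℝ))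
    -- displayed: cover and the □′-count
    (hcover : ∀ (k : ℕ) (y : ι) (a : α) (j : ℕ), ∀ x ∈ P.src k y a j, ∃ q ∈ P.Sq k y a j, x ∈ P.SX k y a j q)
    (hcountQ : ∀ (k : ℕ) (y : ι) (a : α) (j : ℕ), ((P.Sq k y a j).card : ℝ) * gain k j ≤ cQ * ℓ k j) :
    LevelCountsG P κ κ₁ ((m : ℝ) * (2 ^ 20 + 1)) cQ gain ℓ :=
  levelCountsG_of_record R P rd hd hm cube hSX hκ Yout hS0 hdY hκ₁
    hcover hcountQ fun k y a _ => sumY_of_record R P Anc dom hinj hdom hAnc hvol (by linarith) k y a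

end Record

end Summit.QuantumFields.BalabanUV.T4Continuum.NE9LevelCountsAnimal

end
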